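import Mathlib
import Summits.QuantumFields.YangMills.Theses.FlatTubeReduction
import Summits.QuantumFields.YangMills.Theorems.FlatTubeReductionRecordAnalyticRate

/-!
# SKELETON «ratepack» (reshaped g9, K = 43) for the crux K1 `NearFlatRatioLaw` (stmt-QuantumFields-24720, route `FlatTubeReduction`) — ONE STUB: the RATE-GRADE Born–Oppenheimer
# TUBE PACKAGE in RED lane A's support-separated currency for the record weight `recordChi L (1/40) 43 M` (orbit factor 43, some fat factor `M ≥ 2`), on every `L ≥ 2`

Seat `ym-line-ftr-p1` g9 (2026-08-28).  Why K = 43 (not 3): lane A's slow-shadow lemma (S1) forces the slow window radius `δ₁ = 14β^{-s}/|Site|`, and BO functions over that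
window are supported in the fat tube only if `|Edge|(4r + δ₁) < Kβ^{-s}`, i.e. `K > 42` (`record_structural_inequalities`, p652155).  The stub is PROVED by supplying the hand-off
object `RateTube.RecordAnalyticRateInput L (1/40) M` (`Theorems/FlatTubeReductionRecordAnalyticRate.lean`): `fun L _ hL => softTubeBORatePackageOn_of_rateBricks (boRateBricks_record
… ((A L hL).toRecordBORateInput …))`.  Composition below = `innerRateAt_of_ratePackage` (p648741) + `softTubeAdmissible_recordChi'` + `nearFlatRatioLaw_of_innerRate` (p626045); the
same stub closes FCL 23943.
* `stub_ratePackage` — `∃ M ≥ 2, ∀ L ≥ 2, RateTube.SoftTubeBORatePackageOn L (recordChi L (1/40) 43 M) {orbitDist < β^{−1/40}}`.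
OWED (= the fields of `RecordAnalyticRateInput`): adapted equivariant profile `Ω β u v` (+ radius), dressed weight `W β u` (+ vacuum behaviour `1 ≤ W²(1+κ_W‖zm‖²)`), constants,
(B-N) on the window (fibrewise normalisation), (B-T)-RATE against `⟨φW, K_{L³β} φW⟩`, (B-ST), (B-OD) with `b² = O(λ_b²)` — pooled with RED lane A's C4-CORE (crux 20203,
`RecordAnalyticInput`, first order).  Landed rate-side chain: p647846 p648741 p648949 p650289 p650583 p651403 p651470 p652029 p652213 p653219 (+ RecordAnalyticRate).
HONEST FRAMING: the stub is OPEN fixed-lattice semiclassics on `SU(2)^{3L³}` (XL); femto rung R2b1 (RECORD label) — not infinite volume, not a mass gap, not Clay.  No summit is proved.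
-/

set_option autoImplicit false

noncomputable section

open Summit.QuantumFields.YangMills.Theorems.FemtoTransferGap
open Summit.QuantumFields.YangMills.Theorems.FemtoTransferGap.TwoLattice.ConstTube
open Summit.QuantumFields.YangMills.Theorems.FemtoCutoffLadder

namespace Summit.QuantumFields.YangMills.Cruxes.NearFlatRatioLaw.RatePack

/-- stub (the ONLY one; HARDEST; pooled with RED lane A's C4-CORE / FCL 23943): for some fat factor `M ≥ 2`, the rate-grade Born–Oppenheimer tube package for the record weight
`recordChi L (1/40) 43 M = recordWeightRho (43β^{−1/40}) (43Mβ^{−1/40}) (β^{−1})`, test functions in `{orbitDist < β^{−1/40}}`, on every lattice of size `L ≥ 2`. -/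
theorem stub_ratePackage : ∃ M : ℝ, 2 ≤ M ∧ ∀ (L : ℕ) [NeZero L], 2 ≤ L →
    RateTube.SoftTubeBORatePackageOn L (recordChi L (1 / 40) 43 M) (fun β => {U | orbitDist U < powScale (1 / 40) β}) := by
  sorry

/-- ★ The crux BY NAME from exactly the one declared stub: `innerRateAt_of_ratePackage` (Feshbach endgame at rate grade, slice identities, eight copies) for the admissible
record weight, then `nearFlatRatioLaw_of_innerRate`. -/
theorem NearFlatRatioLaw_holds_of_stubs : Summit.QuantumFields.YangMills.Theses.FlatTubeReduction.NearFlatRatioLaw :=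
  stub_ratePackage.elim fun M h =>
    Summit.QuantumFields.YangMills.Theorems.FlatTubeReduction.nearFlatRatioLaw_of_innerRate fun L _ hL =>
      RateTube.innerRateAt_of_ratePackage (L := L) 1 (fun β => powScale_pos (1 / 40) β) RateTube.powScale_fortieth_eventually_le
        (RateTube.softTubeAdmissible_recordChi' (1 / 40) 43 M (by norm_num) h.1) (h.2 L hL)

/-- The same stub closes FCL's crux `FixedLatticeLaw` 23943 (≡ `FemtoGapFixedLattice`; `L = 1` is crux ONE). -/
theorem femtoGapFixedLattice_of_stubs : FemtoGapFixedLattice := by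
  obtain ⟨M, hM, h⟩ := stub_ratePackage
  intro L _
  by_cases hL : 2 ≤ L
  · exact femtoGapFixedLatticeAt_of_valley_innerRate (L := L) (p := 1 / 40) (q := 17 / 20) (by norm_num) (by norm_num) (by norm_num)
      (valleyGainAt_ledger hL)
      (RateTube.innerRateAt_of_ratePackage (L := L) 1 (fun β => powScale_pos (1 / 40) β) RateTube.powScale_fortieth_eventually_le
        (RateTube.softTubeAdmissible_recordChi' (1 / 40) 43 M (by norm_num) hM) (h L hL))
  · have hL1 : L = 1 := by
      have h0 : L ≠ 0 := NeZero.ne L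
      omega
    subst hL1
    exact femtoGapOneSite_proof

end Summit.QuantumFields.YangMills.Cruxes.NearFlatRatioLaw.RatePack

end
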